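import Summits.BirchSwinnertonDyer.BirchSwinnertonDyer.Theorems.UniversalToricDescentGoodLocalTerm
import Summits.BirchSwinnertonDyer.BirchSwinnertonDyer.Theorems.UniversalToricDescentGoodFrobeniusRelation
import Mathlib.Algebra.CharP.Lemmas
import HarnessLib

/-!
# Route UniversalToricDescent — Greenberg–Vatsal Prop. (2.4) at a GOOD place, closed form:
# `s_v = 0, 1, 2` according as `p ∤ #Ẽ(k_v)`; `p ∣ #Ẽ(k_v), p ∤ q_v − 1`; `p ∣ #Ẽ(k_v), p ∣ q_v − 1`

Lead prover bsd-wall-utd-p1 g9 (`--supports stmt-BirchSwinnertonDyer-20399`; closes the good-place part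
of memo GV24-LOCAL-TERM-utdp1g9 §2). Inputs: the count `#{f ∈ H¹(kerD κ v, E[p^∞]) : p f = 0} =
#{P ∈ E[p] : σ^{p^R} P = q_v^{p^R} P}` (`UniversalToricDescentGoodLocalTerm`, p593704) and the Frobenius
relation `σ²P − a_v σP + q_v P = 0` on `E[p]` with the trace congruence (`…GoodFrobeniusRelation`, p594082).

* `natCard_fixed_eq_pow_of_relation` — ABSTRACT COUNT: `V` an abelian group of order `p²` killed by `p`,
  `N ∈ End(V)` with `N² − aN + q = 0` (`a ∈ ℤ`, `q ∈ ℕ`, `p ∤ q`) such that `N ≡ s (scalar) ⟹ p ∣ a − 2s`;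
  then for `R ≥ 1`, `#{P : N^{p^R} P = q^{p^R} P} = p^e` with `e = 0` if `p ∤ q + 1 − a`, `e = 2` if
  `p ∣ q + 1 − a` and `p ∣ q − 1`, `e = 1` otherwise. (In `End(V)`, of characteristic `p`:
  `N^{p^R} − q^{p^R} = B^{p^R}`, `B = N − q`, `B² = (a − 2q)B − q(q + 1 − a)`; `B` is invertible, resp.
  `B² = 0`, resp. `B² = uB` with `u` a unit and `ker B` a line — the scalar cases being excluded by the
  trace congruence.)
* **`natCard_pTorsion_subgroupH1_kerD_eq_pow`** — **Greenberg–Vatsal Prop. (2.4) at a good place**: for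
  `E/K` good at `v ∤ p`, `v` finitely decomposed in the `ℤ_p`-extension `κ`:
  `#{f ∈ H¹(kerD κ v, E[p^∞]) : p f = 0} = p^{d_v}`, `d_v ∈ {0,1,2}` as above with `a = a_v`, `q = q_v`
  (`d_v` = multiplicity of the eigenvalue `q_v` of Frobenius on `E[p]`, [GreenbergVatsal2000] p. 22) —
  so in `invariantsTransportT_algebraicHalf_lambda`, `s_v = d_v` at every good place of `Σ`.

THEOREMS ONLY; no definition, no named fact, no `sorry`. BSD is not advanced by this file.
References: [GreenbergVatsal2000] §2 Prop. (2.4) and p. 27 (`δ = s_ℓ d_ℓ`, `d_ℓ = 2` iff `ℓ ≡ 1 mod p`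
and `a_ℓ ≡ 2`); [GreenbergLNM1716] §3; [SilvermanAEC2009] V.2.3.1, VII.4.1.
-/

set_option autoImplicit false
-- `…BirchSwinnertonDyer.BirchSwinnertonDyer.Theorems…` is the problem's mandated namespace (D-0017).
set_option linter.dupNamespace false

noncomputable section

open scoped Classical

namespace Summit.BirchSwinnertonDyer.BirchSwinnertonDyer.Theorems.UniversalToricDescentGoodLocalTermTrichotomy

open Function NumberField IsDedekindDomain Field ValuativeRel WeierstrassCurve
open Literature.NumberTheory.EllipticCurves Literature.NumberTheory.EllipticCurves.GreenbergSelmer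
  Literature.NumberTheory.GaloisRepresentations
  Literature.NumberTheory.GaloisRepresentations.IsNonarchimedeanLocalField
  IsDedekindDomain.HeightOneSpectrum
  Summit.BirchSwinnertonDyer.Rank1Residual.X11b Summit.BirchSwinnertonDyer.Rank1Residual.X11b.Coinv
  Summit.BirchSwinnertonDyer.BirchSwinnertonDyer.Theorems.UniversalToricDescentGoodLocalTerm
  Summit.BirchSwinnertonDyer.BirchSwinnertonDyer.Theorems.UniversalToricDescentGoodFrobenius

/-! ### §1 The abstract count -/

section Abstract

variable {V : Type} [AddCommGroup V] {p : ℕ} [hp : Fact p.Prime]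

/-- An integer prime to `p` is a (two-sided) unit of `End(V)` when `p = 0` in `End(V)`. [folklore] -/
theorem exists_intCast_mul_eq_one (hp0 : ((p : ℕ) : Module.End ℤ V) = 0) {m : ℤ}
    (hm : ¬ (p : ℤ) ∣ m) :
    ∃ u : ℤ, (m : Module.End ℤ V) * (u : Module.End ℤ V) = 1 ∧
      (u : Module.End ℤ V) * (m : Module.End ℤ V) = 1 := by
  have hpZ : Prime (p : ℤ) := Nat.prime_iff_prime_int.mp hp.out
  have hcop : IsCoprime m (p : ℤ) := (Int.isCoprime_iff_gcd_eq_one.mpr (by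
    rw [Int.gcd_comm]
    exact Int.isCoprime_iff_gcd_eq_one.mp ((Prime.coprime_iff_not_dvd hpZ).mpr hm)))
  obtain ⟨u, w, huw⟩ := hcop
  have h : ((u * m + w * p : ℤ) : Module.End ℤ V) = 1 := by rw [huw, Int.cast_one]
  rw [Int.cast_add, Int.cast_mul, Int.cast_mul, Int.cast_natCast, hp0, mul_zero, add_zero] at h
  refine ⟨u, ?_, h⟩
  rw [← Int.cast_mul, mul_comm, Int.cast_mul]
  exact h

variable [Finite V]

/-- **The abstract count.** Let `V` be an abelian group of order `p²` killed by `p`, `N ∈ End(V)` with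
`N(N P) − a·N P + q·P = 0` (`a ∈ ℤ`, `q ∈ ℕ`, `p ∤ q`), and suppose that whenever `N` acts as an integer
scalar `s` one has `p ∣ a − 2s` (trace congruence). Then for `R ≥ 1`:
`#{P : N^{p^R} P = q^{p^R} • P} = p^e`, `e = 0` if `p ∤ q + 1 − a`; `e = 2` if `p ∣ q + 1 − a`, `p ∣ q − 1`;
`e = 1` if `p ∣ q + 1 − a`, `p ∤ q − 1`. [cite: GreenbergVatsal2000, §2 Prop. (2.4) (p. 22) and p. 27] -/
theorem natCard_fixed_eq_pow_of_relation (hV : Nat.card V = p ^ 2) (hpV : ∀ P : V, p • P = 0)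
    (N : Module.End ℤ V) (a : ℤ) (q : ℕ) (hq : ¬ (p : ℤ) ∣ q)
    (hrel : ∀ P : V, N (N P) - a • N P + q • P = 0)
    (htrace : ∀ s : ℤ, (∀ P : V, N P = s • P) → (p : ℤ) ∣ a - 2 * s)
    {R : ℕ} (hR : 1 ≤ R) :
    Nat.card {P : V // (N ^ p ^ R) P = (q ^ p ^ R) • P} =
      p ^ (if (p : ℤ) ∣ (q : ℤ) + 1 - a then (if (p : ℤ) ∣ (q : ℤ) - 1 then 2 else 1) else 0) := by
  have hpp : p.Prime := hp.out
  have hpZ : Prime (p : ℤ) := Nat.prime_iff_prime_int.mp hpp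
  -- `End(V)` has characteristic `p`
  have hp0 : ((p : ℕ) : Module.End ℤ V) = 0 :=
    LinearMap.ext fun P ↦ by rw [Module.End.natCast_apply, LinearMap.zero_apply]; exact hpV P
  have hcast0 : ∀ m : ℤ, (p : ℤ) ∣ m → (m : Module.End ℤ V) = 0 := by
    rintro m ⟨t, rfl⟩
    rw [Int.cast_mul, Int.cast_natCast, hp0, zero_mul]
  haveI : Nontrivial V := by
    rw [← Finite.one_lt_card_iff_nontrivial, hV]
    exact Nat.one_lt_pow two_ne_zero hpp.one_lt
  haveI : Nontrivial (Module.End ℤ V) := by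
    obtain ⟨P, hP⟩ := exists_ne (0 : V)
    exact ⟨⟨1, 0, fun h ↦ hP (by simpa using congrArg (fun f : Module.End ℤ V ↦ f P) h)⟩⟩
  haveI : CharP (Module.End ℤ V) p := (CharP.charP_iff_prime_eq_zero hpp).mpr hp0
  -- `B = N - q`, the relation `B² = u B - q c`, `u = a - 2q`, `c = q + 1 - a`
  set B : Module.End ℤ V := N - (q : ℕ) with hBdef
  set u : ℤ := a - 2 * q with hudef
  set c : ℤ := (q : ℤ) + 1 - a with hcdef
  have hBapp : ∀ P : V, B P = N P - (q : ℤ) • P := fun P ↦ by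
    rw [hBdef, LinearMap.sub_apply, Module.End.natCast_apply, natCast_zsmul P q]
  have hNapp : ∀ P : V, N P = B P + (q : ℤ) • P := fun P ↦ by rw [hBapp, sub_add_cancel]
  have hrel' : ∀ P : V, N (N P) = a • N P - (q : ℤ) • P := fun P ↦ by
    have h := hrel P
    rw [← natCast_zsmul P q] at h
    calc N (N P) = (N (N P) - a • N P + (q : ℤ) • P) + (a • N P - (q : ℤ) • P) := by abel
      _ = a • N P - (q : ℤ) • P := by rw [h, zero_add]
  have hBB : ∀ P : V, B (B P) = u • B P - ((q : ℤ) * c) • P := fun P ↦ by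
    rw [hBapp, hBapp, map_sub, map_zsmul, hrel', hudef, hcdef]
    module
  have hBBend : B * B = (u : Module.End ℤ V) * B - (((q : ℤ) * c : ℤ) : Module.End ℤ V) :=
    LinearMap.ext fun P ↦ by
      show B (B P) = (u : Module.End ℤ V) (B P) - (((q : ℤ) * c : ℤ) : Module.End ℤ V) P
      rw [Module.End.intCast_apply, Module.End.intCast_apply]
      exact hBB P
  -- `N^{p^R} = B^{p^R} + q^{p^R}` (characteristic `p`)
  have hNpow : N ^ p ^ R = B ^ p ^ R + ((q ^ p ^ R : ℕ) : Module.End ℤ V) := by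
    have hN : N = B + (q : ℕ) := by rw [hBdef, sub_add_cancel]
    rw [hN, add_pow_char_pow_of_commute p R (Nat.cast_commute q B).symm, Nat.cast_pow]
  have hfix : ∀ P : V, (N ^ p ^ R) P = (q ^ p ^ R) • P ↔ (B ^ p ^ R) P = 0 := fun P ↦ by
    rw [hNpow, LinearMap.add_apply, Module.End.natCast_apply, add_eq_right]
  rw [Nat.card_congr (Equiv.subtypeEquivRight hfix)]
  -- `p^R = k + 1 ≥ 2`
  obtain ⟨k, hk⟩ : ∃ k, p ^ R = k + 1 :=
    ⟨p ^ R - 1, (Nat.sub_add_cancel (Nat.one_le_pow R p hpp.pos)).symm⟩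
  have hk1 : 1 ≤ k := by
    have h2 : 2 ≤ p ^ R := le_trans hpp.two_le (by
      calc p = p ^ 1 := (pow_one p).symm
        _ ≤ p ^ R := Nat.pow_le_pow_right hpp.pos hR)
    omega
  -- case analysis
  by_cases hc : (p : ℤ) ∣ (q : ℤ) + 1 - a
  · rw [if_pos hc]
    have hc0 : (((q : ℤ) * c : ℤ) : Module.End ℤ V) = 0 := hcast0 _ (dvd_mul_of_dvd_right hc _)
    rw [hc0, sub_zero] at hBBend
    have hBB' : ∀ P : V, B (B P) = u • B P := fun P ↦ by
      have := congrArg (fun f : Module.End ℤ V ↦ f P) hBBend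
      simpa only [Module.End.mul_apply, Module.End.intCast_apply] using this
    by_cases hq1 : (p : ℤ) ∣ (q : ℤ) - 1
    · -- `B² = 0`: everything is fixed
      rw [if_pos hq1]
      have hu0 : (u : Module.End ℤ V) = 0 := hcast0 u (by
        have : u = -(((q : ℤ) + 1 - a) + ((q : ℤ) - 1)) := by rw [hudef]; ring
        rw [this, dvd_neg]; exact dvd_add hc hq1)
      rw [hu0, zero_mul] at hBBend
      have hBpow : B ^ p ^ R = 0 := by
        rw [hk, ← Nat.sub_add_cancel hk1, add_assoc, one_add_one_eq_two, pow_add, pow_two, hBBend,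
          mul_zero]
      rw [← hV]
      exact Nat.card_congr (Equiv.subtypeUnivEquiv fun P ↦ by rw [hBpow]; rfl)
    · -- `B² = u B`, `u` a unit: the fixed space is the line `ker B`
      rw [if_neg hq1, pow_one]
      have hu : ¬ (p : ℤ) ∣ u := fun h ↦ hq1 (by
        have : (q : ℤ) - 1 = -(u + ((q : ℤ) + 1 - a)) := by rw [hudef]; ring
        rw [this, dvd_neg]; exact dvd_add h hc)
      obtain ⟨u', hu', hu''⟩ := exists_intCast_mul_eq_one (V := V) hp0 hu
      have hBk : ∀ j : ℕ, B ^ (j + 1) = (u : Module.End ℤ V) ^ j * B := by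
        intro j
        induction j with
        | zero => rw [zero_add, pow_one, pow_zero, one_mul]
        | succ j ih => rw [pow_succ, ih, mul_assoc, hBBend, ← mul_assoc, ← pow_succ]
      have hinvk : ((u' : Module.End ℤ V) ^ k) * ((u : Module.End ℤ V) ^ k) = 1 := by
        rw [← (Int.cast_commute u' (u : Module.End ℤ V)).mul_pow, hu'', one_pow]
      have hker : ∀ P : V, (B ^ p ^ R) P = 0 ↔ B P = 0 := by
        intro P
        rw [hk, hBk, Module.End.mul_apply]
        constructor
        · intro h
          have h' := congrArg ((u' : Module.End ℤ V) ^ k) h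
          rw [map_zero, ← Module.End.mul_apply, hinvk, Module.End.one_apply] at h'
          exact h'
        · intro h; rw [h, map_zero]
      rw [Nat.card_congr (Equiv.subtypeEquivRight hker)]
      -- `#ker B = p`: a proper non-trivial subgroup of a group of order `p²`
      let Kr : AddSubgroup V := (LinearMap.ker B).toAddSubgroup
      have hKr : ∀ P : V, P ∈ Kr ↔ B P = 0 := fun P ↦ by
        rw [Submodule.mem_toAddSubgroup, LinearMap.mem_ker]
      have hcong : Nat.card {P : V // B P = 0} = Nat.card Kr :=
        Nat.card_congr (Equiv.subtypeEquivRight fun P ↦ (hKr P).symm)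
      rw [hcong]
      have hcardker : Nat.card Kr ∣ p ^ 2 := by
        rw [← hV]; exact AddSubgroup.card_addSubgroup_dvd_card Kr
      obtain ⟨i, hi, hcard⟩ := (Nat.dvd_prime_pow hpp).mp hcardker
      have hne_top : Kr ≠ ⊤ := by
        intro htop
        apply hu
        have hs : ∀ P : V, N P = (q : ℤ) • P := fun P ↦ by
          have hP : B P = 0 := (hKr P).mp (by rw [htop]; exact AddSubgroup.mem_top P)
          rw [hNapp, hP, zero_add]
        have := htrace q hs
        rwa [hudef]
      have hne_bot : Kr ≠ ⊥ := by
        intro hbot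
        apply hu
        have hinj : Function.Injective B := (injective_iff_map_eq_zero B).mpr fun x hx ↦ by
          have : x ∈ Kr := (hKr x).mpr hx
          rw [hbot] at this
          exact (AddSubgroup.mem_bot).mp this
        have hs : ∀ P : V, N P = (a - q) • P := fun P ↦ by
          have h0 : B (B P - u • P) = 0 := by rw [map_sub, map_zsmul, hBB', sub_self]
          have h1 : B P = u • P := sub_eq_zero.mp (hinj (by rw [h0, map_zero]))
          rw [hNapp, h1, ← add_smul, hudef]
          congr 1; ring
        have h := htrace (a - q) hs
        have : a - 2 * (a - q) = -u := by rw [hudef]; ring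
        rwa [this, dvd_neg] at h
      rw [hcard]
      interval_cases i
      · exfalso; apply hne_bot
        rw [pow_zero] at hcard
        exact AddSubgroup.card_eq_one.mp hcard
      · exact pow_one p
      · exfalso; apply hne_top
        exact (AddSubgroup.card_eq_iff_eq_top Kr).mp (by rw [hcard, hV])
  · -- `B` is invertible: only `0` is fixed
    rw [if_neg hc, pow_zero]
    have hqc : ¬ (p : ℤ) ∣ (q : ℤ) * c := fun h ↦
      (hpZ.dvd_or_dvd h).elim hq (fun h' ↦ hc (by rwa [hcdef] at h'))
    obtain ⟨m', hm', hm''⟩ := exists_intCast_mul_eq_one (V := V) hp0 hqc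
    -- `B (B - u) = -(q c)` and `(B - u) B = -(q c)`
    have hBu : (u : Module.End ℤ V) * B = B * (u : Module.End ℤ V) :=
      (Int.cast_commute u B).eq
    have h1 : B * ((B - (u : Module.End ℤ V)) * (-(m' : Module.End ℤ V))) = 1 := by
      rw [← mul_assoc, mul_sub, hBBend, ← hBu, sub_sub_cancel_left, neg_mul_neg, hm']
    have h2 : ((-(m' : Module.End ℤ V)) * (B - (u : Module.End ℤ V))) * B = 1 := by
      rw [mul_assoc, sub_mul, hBBend, sub_sub_cancel_left, mul_neg, neg_mul, neg_neg, hm'']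
    have hinjB : Function.Injective B := by
      intro x y hxy
      have := congrArg ((-(m' : Module.End ℤ V)) * (B - (u : Module.End ℤ V))) hxy
      rwa [← Module.End.mul_apply, ← Module.End.mul_apply, h2, Module.End.one_apply,
        Module.End.one_apply] at this
    have hinj : ∀ j : ℕ, Function.Injective (B ^ j) := by
      intro j
      induction j with
      | zero => intro x y h; simpa using h
      | succ j ih =>
        intro x y h
        rw [pow_succ, Module.End.mul_apply, Module.End.mul_apply] at h
        exact hinjB (ih h)
    have hunique : ∀ P : V, (B ^ p ^ R) P = 0 ↔ P = 0 := fun P ↦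
      ⟨fun h ↦ hinj _ (by rw [h, map_zero]), fun h ↦ by rw [h, map_zero]⟩
    rw [Nat.card_congr (Equiv.subtypeEquivRight hunique), Nat.card_eq_one_iff_exists]
    exact ⟨⟨0, rfl⟩, fun y ↦ Subtype.ext y.2⟩

end Abstract

/-! ### §2 Greenberg–Vatsal Prop. (2.4) at a good place, closed form -/

variable {K : Type} [Field K] [NumberField K] (W : WeierstrassCurve K) [W.IsElliptic] {p : ℕ}
  [Fact p.Prime] (κ : ZpExtension K p) {v : HeightOneSpectrum (𝓞 K)}

/-- **Greenberg–Vatsal Prop. (2.4) at a place of good reduction (the local term of 21845's algebraic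
half, closed form).** For `E/K` with good reduction at `v ∤ p` and `v` finitely decomposed in the
`ℤ_p`-extension `κ` (`D_v ⊄ ker κ`), with `a_v = W.frobeniusTraceAt v` and `q_v = #k_v`:
`#{f ∈ H¹(kerD κ v, E[p^∞]) : p • f = 0} = p^{d_v}` where `d_v = 0` if `p ∤ q_v + 1 − a_v = #Ẽ(k_v)`,
`d_v = 2` if `p ∣ #Ẽ(k_v)` and `p ∣ q_v − 1`, and `d_v = 1` otherwise — the multiplicity of the eigenvalue
`q_v` of Frobenius on `E[p]`, i.e. of `q_v⁻¹` as a root of the Euler factor `P̃_v` mod `p`.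
[cite: GreenbergVatsal2000, §2 Prop. (2.4) (p. 22) and p. 27] [cite: GreenbergLNM1716, §3 Lemma 3.3] -/
theorem natCard_pTorsion_subgroupH1_kerD_eq_pow (hpv : (p : 𝓞 K) ∉ v.asIdeal)
    (hD : ¬ (decomp v ≤ κ.kerSubgroup)) (hv : W.HasGoodReductionAt v) :
    Nat.card {f : Literature.NumberTheory.EllipticCurves.subgroupH1 (kerD κ v)
        (W.geomPrimaryTorsion p) // p • f = 0} =
      p ^ (if (p : ℤ) ∣ (Nat.card (IsLocalRing.ResidueField (v.adicCompletionIntegers K)) : ℤ) + 1 -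
              W.frobeniusTraceAt v then
            (if (p : ℤ) ∣ (Nat.card (IsLocalRing.ResidueField (v.adicCompletionIntegers K)) : ℤ) - 1
              then 2 else 1)
          else 0) := by
  have hpp : p.Prime := Fact.out
  haveI : CharZero (v.adicCompletion K) :=
    charZero_of_injective_algebraMap (algebraMap K (v.adicCompletion K)).injective
  -- an arithmetic Frobenius of `K_v`
  obtain ⟨φ, hφ⟩ := exists_isFrobPow_holds (v.adicCompletion K) 1
  obtain ⟨R₀, hR₀⟩ := exists_forall_natCard_pTorsion_subgroupH1_kerD_eq W κ hpv hD hv hφ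
  set R := max R₀ 1 with hRdef
  rw [hR₀ R (le_max_left _ _), map_pow,
    Summit.BirchSwinnertonDyer.BirchSwinnertonDyer.Theorems.SigmaLocal.residueFieldCard_eq_natCard_residueField]
  -- the abstract count on `V = E[p]`
  set q : ℕ := Nat.card (IsLocalRing.ResidueField (v.adicCompletionIntegers K)) with hqdef
  set σ : absoluteGaloisGroup K := absGaloisRestrict K (v.adicCompletion K) φ with hσdef
  let N : Module.End ℤ (W.geomTorsion (p : ℤ)) :=
    DistribMulAction.toModuleEnd ℤ (W.geomTorsion (p : ℤ)) σ
  have hN : ∀ P : W.geomTorsion (p : ℤ), N P = σ • P := fun _ ↦ rfl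
  have hNpow : ∀ (j : ℕ) (P : W.geomTorsion (p : ℤ)), (N ^ j) P = (σ ^ j) • P := fun j P ↦ by
    show ((DistribMulAction.toModuleEnd ℤ (W.geomTorsion (p : ℤ))) σ ^ j) P = _
    rw [← map_pow]
    rfl
  haveI : Finite (W.geomTorsion (p : ℤ)) :=
    finite_torsionPoints_holds W (AlgebraicClosure K) (by exact_mod_cast hpp.ne_zero)
  have hV : Nat.card (W.geomTorsion (p : ℤ)) = p ^ 2 :=
    card_torsionPoints_eq_sq_holds W (AlgebraicClosure K) (by
      haveI : CharZero (AlgebraicClosure K) :=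
        charZero_of_injective_algebraMap (algebraMap K (AlgebraicClosure K)).injective
      exact_mod_cast hpp.ne_zero)
  have hpV : ∀ P : W.geomTorsion (p : ℤ), p • P = 0 := fun P ↦ Subtype.ext (by
    rw [AddSubgroupClass.coe_nsmul, ZeroMemClass.coe_zero, ← natCast_zsmul]
    exact (mem_geomTorsion_iff W (p : ℤ) _).mp P.2)
  have hq : ¬ (p : ℤ) ∣ q := by
    intro h
    have hu := Summit.BirchSwinnertonDyer.BirchSwinnertonDyer.Theorems.SigmaLocal.isUnit_residueFieldCard_padicInt
      (p := p) (w := v) hpv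
    rw [Summit.BirchSwinnertonDyer.BirchSwinnertonDyer.Theorems.SigmaLocal.residueFieldCard_eq_natCard_residueField,
      ← hqdef, PadicInt.isUnit_iff] at hu
    have hlt : ‖((q : ℤ) : ℤ_[p])‖ < 1 := (PadicInt.norm_int_lt_one_iff_dvd _).mpr h
    rw [Int.cast_natCast, hu] at hlt
    exact lt_irrefl _ hlt
  have hrel : ∀ P : W.geomTorsion (p : ℤ), N (N P) - (W.frobeniusTraceAt v) • N P + q • P = 0 :=
    fun P ↦ smul_smul_sub_smul_add_smul_eq_zero W hpv hv hφ P
  have htrace : ∀ s : ℤ, (∀ P : W.geomTorsion (p : ℤ), N P = s • P) →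
      (p : ℤ) ∣ W.frobeniusTraceAt v - 2 * s := fun s hs ↦
    dvd_frobeniusTraceAt_sub_two_mul W hpv hv hφ hs
  rw [← natCard_fixed_eq_pow_of_relation hV hpV N (W.frobeniusTraceAt v) q hq hrel htrace
    (le_max_right R₀ 1)]
  exact Nat.card_congr (Equiv.subtypeEquivRight fun P ↦ by rw [hNpow])

end Summit.BirchSwinnertonDyer.BirchSwinnertonDyer.Theorems.UniversalToricDescentGoodLocalTermTrichotomy

end
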